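import Summits.AnomalousDissipation.AnomalousDissipation.Theorems.SolenoidalFractalHomogenisationLagrangianStepW7SlotStepR
import Summits.AnomalousDissipation.AnomalousDissipation.Theorems.SolenoidalFractalHomogenisationLagrangianStepW7ThreeModeFibreR
import Summits.AnomalousDissipation.AnomalousDissipation.Theorems.SolenoidalFractalHomogenisationLagrangianStepW7CellSlot
import Summits.AnomalousDissipation.AnomalousDissipation.Theorems.SolenoidalFractalHomogenisationLagrangianStepCellChainSlotStepInputsFrame
import HarnessLib

/-!
# K1L_D (stmt-AnomalousDissipation-27980), (ℓ3) (D-TH)₀ — W7 ENGINE S1b AT A FROZEN FRAME `G₀`: THE CELL SLOT CONTRACTION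
# (the abstract slot step `W7Slot.slot_stepR` instantiated on w1's frozen-frame mode calculus and the frozen S1a inputs)
# (helper; `--supports stmt-AnomalousDissipation-27980 --as helper`)

Port plan B9 (`HOME/ad-sawtooth-k1loc-p1/g16/W7thg-portplan-k1locp1g16.md`; prover ad-sawtooth-k1loc-p1 g16): the frozen-frame twin of
`W7Cell.cell_slot_contraction` (`…W7CellSlot`).  For a weak solution `u` of the distorted cell problem
`IsWeakTensorPassiveVectorDistortedOn 0 T 𝔹 (W₁.cell n) (fun _ _ => G₀) F u` (`NearIso 𝔹 lo hi`, `0 < lo`, `OddSmall 𝔹 β`, triangle envelopes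
`ramp = 1/2`), an energy pair `E, Q` as in w1's `exists_energyRep_cell_frame` (conjugated symbol form, a.e. coercivity constant `loc`), ONE slot `s` in
period `p` whose window lies in `[0,T]`, and ONE slow chain `K₀ + j·K_s` whose TWISTED wave vectors `G₀ᵀKⱼ` satisfy the window inequalities
`dmin, dtwo, Dmax, d0, D0` (stated with `|G₀ᵀKⱼ|² = Σ_b twistFreq G₀ Kⱼ b²`), the Young constraints (c1)–(c4), the cap (c5) and the twisted drain floor `q`,
and off which every carried mode dissipates at rate `≥ dmin/2`:
**`cell_slot_contractionR`** — `E(pP + start s + τ_s) ≤ exp(−ε c² q τ_s/27) · E(pP + start s)`, `c = |ê_s·K₀|(1/n)/(2|m_s|)`.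
Ingredients: the generic-damping slot step `W7Slot.slot_stepR` (p725843) fed with the twisted generator's transversality / coercivity / norm bound
(`rdot_twistGen_eq_zero`, `coercivity_twistGen`, `norm_twistGen_le` of `…W7ThreeModeFibreR`, at the tensor `𝔹ᵀ` via `Visc4.conj_majorTranspose`,
`nearIso_majorTranspose_iff`, `OddSmall.majorTranspose`), the frozen S1a inputs `…CellChainSlotStepInputsFrame`, the flat envelope / period bricks
(`…W7Envelope`, `…W7Period`) and `W7Cell.slot_rate_floor` BY NAME.  No definitions, no sorry.  NOT a proof of `stub_W7thg`, of K1L_D or of AD; rung F-D1.A0.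
[cite: BedrossianCotiZelati2017, §2 (hypocoercivity functional with a cross term, Grönwall)] [problem: turb]
-/

set_option linter.dupNamespace false

noncomputable section

namespace Summit.AnomalousDissipation.AnomalousDissipation.Theorems.SolenoidalFractalHomogenisation.LagrangianStep.W7Cell

open Set Real MeasureTheory intervalIntegral Filter Topology Function Complex UnitAddTorus
open scoped InnerProductSpace ComplexConjugate
open Literature.Analysis Literature.Analysis.FunctionSpaces Literature.Analysis.FunctionSpaces.Torus
open Literature.Analysis.FluidPDE Literature.Analysis.FluidPDE.Torus Literature.Analysis.FluidPDE.LatticeShear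
open Summit.AnomalousDissipation.AnomalousDissipation.Theorems.SolenoidalFractalHomogenisation.LagrangianStep.ThreeMode
open Summit.AnomalousDissipation.AnomalousDissipation.Theorems.SolenoidalFractalHomogenisation.LagrangianStep.W7Engine
open Summit.AnomalousDissipation.AnomalousDissipation.Theorems.SolenoidalFractalHomogenisation.LagrangianStep.W7Slot
open Summit.AnomalousDissipation.AnomalousDissipation.Theorems.SolenoidalFractalHomogenisation.LagrangianStep.CellChain
open Summit.AnomalousDissipation.AnomalousDissipation.Theorems.SolenoidalFractalHomogenisation.PermissibleCarrier
  (trapezoid_nonneg trapezoid_le_one continuous_trapezoid)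

variable {k₀ : ℕ}

set_option maxHeartbeats 800000 in
/-- **THE CELL SLOT CONTRACTION AT A FROZEN FRAME** (W7 engine (R-a), twisted; see the module docstring): on the window of slot `s`, period `p`,
`E(pP + start s + τ_s) ≤ exp(−ε c² q τ_s/27)·E(pP + start s)`, `c = |ê_s·K₀|(1/n)/(2|m_s|)`.
[cite: BedrossianCotiZelati2017, §2 (hypocoercivity functional with a cross term, Grönwall)] -/
theorem cell_slot_contractionR (W₁ : LatticeWord k₀) (n : ℕ) {T : ℝ} (hT : 0 < T) {𝔹 : Torus.Visc4 (Fin 3)} {G₀ : Matrix (Fin 3) (Fin 3) ℝ}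
    {lo hi β : ℝ} (h𝔹 : Torus.NearIso 𝔹 lo hi) (hlo : 0 < lo) (hhi : 0 ≤ hi) (hodd : Torus.OddSmall 𝔹 β) (hβ : 0 ≤ β)
    {F : UnitAddTorus (Fin 3) → EuclideanSpace ℝ (Fin 3)} {u : ℝ → UnitAddTorus (Fin 3) → EuclideanSpace ℝ (Fin 3)}
    (hF : Integrable F volume) (h : Torus.IsWeakTensorPassiveVectorDistortedOn 0 T 𝔹 (W₁.cell n) (fun _ _ => G₀) F u) (hramp : W₁.ramp = 1 / 2)
    {E Q : ℝ → ℝ} {loc : ℝ} (hEcont : ContinuousOn E (Icc 0 T))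
    (hEac : ∀ a ∈ Icc 0 T, ∀ b' ∈ Icc 0 T, AbsolutelyContinuousOnInterval E a b')
    (hEae : ∀ᵐ t ∂(volume.restrict (Ioo 0 T)), E t = ∫ x, ‖u t x‖ ^ 2)
    (hEd : ∀ᵐ t ∂(volume : Measure ℝ), t ∈ Ioo 0 T → HasDerivAt E (-(2 * Q t)) t)
    (hQS : ∀ᵐ t ∂(volume.restrict (Ioo 0 T)), ∀ S : Finset (Fin 3 → ℤ),
      4 * Real.pi ^ 2 * ∑ k ∈ S, (⟪mFourierCoeff (EuclideanSpace.complexify ∘ u t) k,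
        Torus.symbT (Torus.Visc4.conj G₀ 𝔹) k (mFourierCoeff (EuclideanSpace.complexify ∘ u t) k)⟫_ℂ).re ≤ Q t)
    (hcoer : ∀ᵐ t ∂(volume.restrict (Ioo 0 T)), ∀ k : Fin 3 → ℤ,
      loc * (freqNormSq k * ‖mFourierCoeff (EuclideanSpace.complexify ∘ u t) k‖ ^ 2) ≤
        (⟪mFourierCoeff (EuclideanSpace.complexify ∘ u t) k, Torus.symbT (Torus.Visc4.conj G₀ 𝔹) k (mFourierCoeff (EuclideanSpace.complexify ∘ u t) k)⟫_ℂ).re)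
    (s : Fin k₀) (p : ℤ) (ht₀ : 0 ≤ (p * W₁.period + W₁.start s)) (ht₁ : ((p * W₁.period + W₁.start s) + (W₁.phase s).τ) ≤ T)
    (K0 : Fin 3 → ℤ) (hKs : (fun i => (W₁.phase s).m i * (n : ℤ)) ≠ 0)
    (hdisj : ∀ j ∈ ({-2, -1, 0, 1, 2} : Finset ℤ), ∀ j' ∈ ({-2, -1, 0, 1, 2} : Finset ℤ),
      K0 + j • (fun i => (W₁.phase s).m i * (n : ℤ)) ≠ -(K0 + j' • (fun i => (W₁.phase s).m i * (n : ℤ))))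
    {dmin dtwo Dmax d0 D0 ε q c : ℝ} (hdmin : 0 < dmin) (hdtwo : 0 ≤ dtwo) (hd0 : 0 ≤ d0) (hD0 : 0 ≤ D0) (hε : 0 ≤ ε) (hq0 : 0 ≤ q) (hq2 : q ≤ 2)
    (hc : c = |∑ a, (W₁.phase s).e a * (K0 a : ℝ)| * (1 / (n : ℝ)) / (2 * ‖latticeVec (W₁.phase s).m‖))
    (hdp : dmin ≤ 4 * Real.pi ^ 2 * lo * (∑ b, Torus.twistFreq G₀ (K0 + (1:ℤ) • (fun i => (W₁.phase s).m i * (n : ℤ))) b ^ 2)) (hdm : dmin ≤ 4 * Real.pi ^ 2 * lo * (∑ b, Torus.twistFreq G₀ (K0 + (-1:ℤ) • (fun i => (W₁.phase s).m i * (n : ℤ))) b ^ 2))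
    (hdpp : dtwo ≤ 4 * Real.pi ^ 2 * lo * (∑ b, Torus.twistFreq G₀ (K0 + (2:ℤ) • (fun i => (W₁.phase s).m i * (n : ℤ))) b ^ 2)) (hdmm : dtwo ≤ 4 * Real.pi ^ 2 * lo * (∑ b, Torus.twistFreq G₀ (K0 + (-2:ℤ) • (fun i => (W₁.phase s).m i * (n : ℤ))) b ^ 2))
    (hDp : 4 * Real.pi ^ 2 * (hi + β / 2) * (∑ b, Torus.twistFreq G₀ (K0 + (1:ℤ) • (fun i => (W₁.phase s).m i * (n : ℤ))) b ^ 2) ≤ Dmax)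
    (hDm : 4 * Real.pi ^ 2 * (hi + β / 2) * (∑ b, Torus.twistFreq G₀ (K0 + (-1:ℤ) • (fun i => (W₁.phase s).m i * (n : ℤ))) b ^ 2) ≤ Dmax) (hdD : dmin ≤ Dmax)
    (c1 : 8 * ε * c ^ 2 ≤ dmin) (c2 : 4 * ε * Dmax ^ 2 ≤ dmin) (c3 : ε * c ^ 2 ≤ dtwo)
    (hd0le : d0 ≤ 4 * Real.pi ^ 2 * lo * (∑ b, Torus.twistFreq G₀ (K0 + (0:ℤ) • (fun i => (W₁.phase s).m i * (n : ℤ))) b ^ 2)) (hD0ge : 4 * Real.pi ^ 2 * (hi + β / 2) * (∑ b, Torus.twistFreq G₀ (K0 + (0:ℤ) • (fun i => (W₁.phase s).m i * (n : ℤ))) b ^ 2) ≤ D0)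
    (c4 : 32 * ε ^ 2 * c ^ 2 * D0 ^ 2 ≤ d0 * dmin)
    (c5 : 64 * 27 * ε ≤ 7 * q * dmin * (W₁.phase s).τ ^ 2)
    (hqw : ∀ z : EuclideanSpace ℂ (Fin 3), Torus.rdot (Torus.twistFreq G₀ (K0 + (0:ℤ) • (fun i => (W₁.phase s).m i * (n : ℤ)))) z = 0 →
      q * ‖z‖ ^ 2 ≤ ‖Torus.transversalProjR (Torus.twistFreq G₀ (K0 + (1:ℤ) • (fun i => (W₁.phase s).m i * (n : ℤ)))) z‖ ^ 2 + ‖Torus.transversalProjR (Torus.twistFreq G₀ (K0 + (-1:ℤ) • (fun i => (W₁.phase s).m i * (n : ℤ)))) z‖ ^ 2)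
    (hgap : ∀ᵐ t ∂(volume.restrict (Ioo 0 T)), ∀ k : Fin 3 → ℤ,
      (∀ j ∈ ({-2, -1, 0, 1, 2} : Finset ℤ), k ≠ K0 + j • (fun i => (W₁.phase s).m i * (n : ℤ)) ∧ k ≠ -(K0 + j • (fun i => (W₁.phase s).m i * (n : ℤ)))) →
      mFourierCoeff (EuclideanSpace.complexify ∘ u t) k ≠ 0 → dmin ≤ 8 * Real.pi ^ 2 * loc * freqNormSq k) :
    E ((p * W₁.period + W₁.start s) + (W₁.phase s).τ) ≤ Real.exp (-(ε * c ^ 2 * q * (W₁.phase s).τ / 27)) * E (p * W₁.period + W₁.start s) := by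
  have hτ : 0 < (W₁.phase s).τ := (W₁.phase s).τ_pos
  have hρ : 0 < W₁.ramp := W₁.ramp_pos
  have hρ2 : W₁.ramp ≤ 1 / 2 := W₁.ramp_le
  have hlt : (p * W₁.period + W₁.start s) < ((p * W₁.period + W₁.start s) + (W₁.phase s).τ) := by linarith
  have hτeq : ((p * W₁.period + W₁.start s) + (W₁.phase s).τ) - (p * W₁.period + W₁.start s) = (W₁.phase s).τ := by ring
  have ht0I : (p * W₁.period + W₁.start s) ∈ Icc 0 T := ⟨ht₀, by linarith⟩
  have ht1I : ((p * W₁.period + W₁.start s) + (W₁.phase s).τ) ∈ Icc 0 T := ⟨by linarith, ht₁⟩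
  have hsubI : Icc (p * W₁.period + W₁.start s) ((p * W₁.period + W₁.start s) + (W₁.phase s).τ) ⊆ Icc 0 T := Icc_subset_Icc ht₀ ht₁
  -- the sign choice `σ = sgn(ê_s·K₀)` and the link constant `c_σ = c ≥ 0`
  obtain ⟨σ, hσ, hσθ⟩ : ∃ σ : ℝ, (σ = 1 ∨ σ = -1) ∧ σ * (∑ a, (W₁.phase s).e a * (K0 a : ℝ))
      = |∑ a, (W₁.phase s).e a * (K0 a : ℝ)| := ⟨_, (sgn_choice _).1, (sgn_choice _).2⟩
  have hcσ : (σ * (∑ a, (W₁.phase s).e a * (K0 a : ℝ)) * (1 / (n : ℝ)) / (2 * ‖latticeVec (W₁.phase s).m‖)) = c := by rw [hc, hσθ]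
  have hc0 : 0 ≤ c := by rw [hc]; positivity
  -- the tensor seen by the twisted chain ODE: `(𝔹^{G₀})ᵀ = (𝔹ᵀ)^{G₀}`
  have h𝔹T : Torus.NearIso (Torus.majorTranspose 𝔹) lo hi := (Torus.nearIso_majorTranspose_iff 𝔹 lo hi).2 h𝔹
  have hoddT : Torus.OddSmall (Torus.majorTranspose 𝔹) β := hodd.majorTranspose
  have hconjT : Torus.Visc4.conj G₀ (Torus.majorTranspose 𝔹) = Torus.majorTranspose (Torus.Visc4.conj G₀ 𝔹) := Torus.Visc4.conj_majorTranspose G₀ 𝔹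
  -- the envelope of the slot
  obtain ⟨Ad, hAd2', hAd⟩ := exists_ae_hasDerivAt_trapezoid (p * W₁.period + W₁.start s) hτ hρ hρ2
  have hAd2 : ∀ᵐ t, t ∈ uIcc (p * W₁.period + W₁.start s) ((p * W₁.period + W₁.start s) + (W₁.phase s).τ) → Ad t ^ 2 ≤ 4 / (((p * W₁.period + W₁.start s) + (W₁.phase s).τ) - (p * W₁.period + W₁.start s)) ^ 2 := by
    refine Filter.Eventually.of_forall fun t _ => ?_
    rw [hτeq]
    have h1 := hAd2' t
    rw [hramp] at h1
    have h2 : (1 / (1 / 2 * (W₁.phase s).τ)) ^ 2 = 4 / (W₁.phase s).τ ^ 2 := by field_simp; ring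
    rw [h2] at h1
    exact h1
  have hAd1 : ∀ᵐ t, t ∈ uIcc (p * W₁.period + W₁.start s) ((p * W₁.period + W₁.start s) + (W₁.phase s).τ) → HasDerivAt (fun t => LatticeWord.trapezoid (p * W₁.period + W₁.start s) (W₁.phase s).τ W₁.ramp t) (Ad t) t := hAd.mono fun t ht _ => ht
  have hA01 : ∀ t ∈ Icc (p * W₁.period + W₁.start s) ((p * W₁.period + W₁.start s) + (W₁.phase s).τ), 0 ≤ LatticeWord.trapezoid (p * W₁.period + W₁.start s) (W₁.phase s).τ W₁.ramp t ∧ LatticeWord.trapezoid (p * W₁.period + W₁.start s) (W₁.phase s).τ W₁.ramp t ≤ 1 :=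
    fun t _ => ⟨trapezoid_nonneg _ _ _ _, trapezoid_le_one _ _ _ _⟩
  -- (S1a, frozen) the chain ODE on the window, link `c·A`
  have hd0' : ∀ᵐ t, t ∈ uIcc (p * W₁.period + W₁.start s) ((p * W₁.period + W₁.start s) + (W₁.phase s).τ) → HasDerivAt (fun x => (((σ : ℂ) * starRingEnd ℂ (Complex.exp ((W₁.phase s).φ * Complex.I))) ^ (0:ℤ) • modeRepθ W₁ n 𝔹 G₀ F u (K0 + (0:ℤ) • (fun i => (W₁.phase s).m i * (n : ℤ))) x))
      (dW0R (c * LatticeWord.trapezoid (p * W₁.period + W₁.start s) (W₁.phase s).τ W₁.ramp t) (Torus.twistFreq G₀ (K0 + (0:ℤ) • (fun i => (W₁.phase s).m i * (n : ℤ)))) (((σ : ℂ) * starRingEnd ℂ (Complex.exp ((W₁.phase s).φ * Complex.I))) ^ (1:ℤ) • modeRepθ W₁ n 𝔹 G₀ F u (K0 + (1:ℤ) • (fun i => (W₁.phase s).m i * (n : ℤ))) t) (((σ : ℂ) * starRingEnd ℂ (Complex.exp ((W₁.phase s).φ * Complex.I))) ^ (-1:ℤ) • modeRepθ W₁ n 𝔹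 G₀ F u (K0 + (-1:ℤ) • (fun i => (W₁.phase s).m i * (n : ℤ))) t) (((4 * Real.pi ^ 2 : ℝ) : ℂ) • Torus.transversalProjR (Torus.twistFreq G₀ (K0 + (0:ℤ) • (fun i => (W₁.phase s).m i * (n : ℤ)))) (Torus.symbT (Torus.majorTranspose (Torus.Visc4.conj G₀ 𝔹)) (K0 + (0:ℤ) • (fun i => (W₁.phase s).m i * (n : ℤ))) (((σ : ℂ) * starRingEnd ℂ (Complex.exp ((W₁.phase s).φ * Complex.I))) ^ (0:ℤ) • modeRepθ W₁ n 𝔹 G₀ F u (K0 + (0:ℤ) • (fun i => (W₁.phase s).m i * (n : ℤ))) t)))) t := by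
    filter_upwards [ae_uIcc_hasDerivAt_dW0R_frame W₁ n hT.le h hF s K0 hσ p ht₀ ht₁] with t ht htI
    have h2 := ht htI
    rw [hcσ] at h2
    exact h2
  have hdp' : ∀ᵐ t, t ∈ uIcc (p * W₁.period + W₁.start s) ((p * W₁.period + W₁.start s) + (W₁.phase s).τ) → HasDerivAt (fun x => (((σ : ℂ) * starRingEnd ℂ (Complex.exp ((W₁.phase s).φ * Complex.I))) ^ (1:ℤ) • modeRepθ W₁ n 𝔹 G₀ F u (K0 + (1:ℤ) • (fun i => (W₁.phase s).m i * (n : ℤ))) x))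
      (dWpR (c * LatticeWord.trapezoid (p * W₁.period + W₁.start s) (W₁.phase s).τ W₁.ramp t) (Torus.twistFreq G₀ (K0 + (1:ℤ) • (fun i => (W₁.phase s).m i * (n : ℤ)))) (((σ : ℂ) * starRingEnd ℂ (Complex.exp ((W₁.phase s).φ * Complex.I))) ^ (0:ℤ) • modeRepθ W₁ n 𝔹 G₀ F u (K0 + (0:ℤ) • (fun i => (W₁.phase s).m i * (n : ℤ))) t) (((σ : ℂ) * starRingEnd ℂ (Complex.exp ((W₁.phase s).φ * Complex.I))) ^ (2:ℤ) • modeRepθ W₁ n 𝔹 G₀ F u (K0 + (2:ℤ) • (fun i => (W₁.phase s).m i * (n : ℤ))) t) (((4 * Real.pi ^ 2 : ℝ) : ℂ) • Torus.transversalProjR (Torus.twistFreq G₀ (K0 + (1:ℤ) • (fun i => (W₁.phase s).m i * (n : ℤ)))) (Torus.symbT (Torus.majorTranspose (Torus.Visc4.conj G₀ 𝔹)) (K0 + (1:ℤ) • (fun i => (W₁.phase s).m i * (n : ℤ))) (((σ : ℂ) * starRingEnd ℂ (Complex.exp ((W₁.phase s).φ * Complex.I))) ^ (1:ℤ) • modeRepθ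 W₁ n 𝔹 G₀ F u (K0 + (1:ℤ) • (fun i => (W₁.phase s).m i * (n : ℤ))) t)))) t := by
    filter_upwards [ae_uIcc_hasDerivAt_dWpR_frame W₁ n hT.le h hF s K0 hσ p ht₀ ht₁] with t ht htI
    have h2 := ht htI
    rw [hcσ] at h2
    exact h2
  have hdm' : ∀ᵐ t, t ∈ uIcc (p * W₁.period + W₁.start s) ((p * W₁.period + W₁.start s) + (W₁.phase s).τ) → HasDerivAt (fun x => (((σ : ℂ) * starRingEnd ℂ (Complex.exp ((W₁.phase s).φ * Complex.I))) ^ (-1:ℤ) • modeRepθ W₁ n 𝔹 G₀ F u (K0 + (-1:ℤ) • (fun i => (W₁.phase s).m i * (n : ℤ))) x))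
      (dWmR (c * LatticeWord.trapezoid (p * W₁.period + W₁.start s) (W₁.phase s).τ W₁.ramp t) (Torus.twistFreq G₀ (K0 + (-1:ℤ) • (fun i => (W₁.phase s).m i * (n : ℤ)))) (((σ : ℂ) * starRingEnd ℂ (Complex.exp ((W₁.phase s).φ * Complex.I))) ^ (0:ℤ) • modeRepθ W₁ n 𝔹 G₀ F u (K0 + (0:ℤ) • (fun i => (W₁.phase s).m i * (n : ℤ))) t) (((σ : ℂ) * starRingEnd ℂ (Complex.exp ((W₁.phase s).φ * Complex.I))) ^ (-2:ℤ) • modeRepθ W₁ n 𝔹 G₀ F u (K0 + (-2:ℤ) • (fun i => (W₁.phase s).m i * (n : ℤ))) t) (((4 * Real.pi ^ 2 : ℝ) : ℂ) • Torus.transversalProjR (Torus.twistFreq G₀ (K0 + (-1:ℤ) • (fun i => (W₁.phase s).m i * (n : ℤ)))) (Torus.symbT (Torus.majorTranspose (Torus.Visc4.conj G₀ 𝔹)) (K0 + (-1:ℤ) • (fun i => (W₁.phase s).m i * (n : ℤ))) (((σ : ℂ) * starRingEnd ℂ (Complex.exp ((W₁.phase s).φ * Complex.I))) ^ (-1:ℤ)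 • modeRepθ W₁ n 𝔹 G₀ F u (K0 + (-1:ℤ) • (fun i => (W₁.phase s).m i * (n : ℤ))) t)))) t := by
    filter_upwards [ae_uIcc_hasDerivAt_dWmR_frame W₁ n hT.le h hF s K0 hσ p ht₀ ht₁] with t ht htI
    have h2 := ht htI
    rw [hcσ] at h2
    exact h2
  -- (S1a, frozen) twisted transversality on the slot, absolute continuity, the drain floor
  have hTj : ∀ (j : ℤ), ∀ t ∈ Icc (p * W₁.period + W₁.start s) ((p * W₁.period + W₁.start s) + (W₁.phase s).τ),
      Torus.rdot (Torus.twistFreq G₀ (K0 + j • (fun i => (W₁.phase s).m i * (n : ℤ)))) (((σ : ℂ) * starRingEnd ℂ (Complex.exp ((W₁.phase s).φ * Complex.I))) ^ j • modeRepθ W₁ n 𝔹 G₀ F u (K0 + j • (fun i => (W₁.phase s).m i * (n : ℤ))) t) = 0 := by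
    intro j t htI
    rw [map_smul, rdot_modeRepθ W₁ n hT.le h _ (hsubI htI), smul_zero]
  have hTY : ∀ (j : ℤ), ∀ t ∈ Icc (p * W₁.period + W₁.start s) ((p * W₁.period + W₁.start s) + (W₁.phase s).τ),
      Torus.rdot (Torus.twistFreq G₀ (K0 + j • (fun i => (W₁.phase s).m i * (n : ℤ)))) (((4 * Real.pi ^ 2 : ℝ) : ℂ) • Torus.transversalProjR (Torus.twistFreq G₀ (K0 + j • (fun i => (W₁.phase s).m i * (n : ℤ))))
        (Torus.symbT (Torus.majorTranspose (Torus.Visc4.conj G₀ 𝔹)) (K0 + j • (fun i => (W₁.phase s).m i * (n : ℤ))) (((σ : ℂ) * starRingEnd ℂ (Complex.exp ((W₁.phase s).φ * Complex.I))) ^ j • modeRepθ W₁ n 𝔹 G₀ F u (K0 + j • (fun i => (W₁.phase s).m i * (n : ℤ))) t))) = 0 :=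
    fun j t _ => rdot_twistGen_eq_zero _ G₀ _ _
  have hacj : ∀ (j : ℤ), AbsolutelyContinuousOnInterval
      (fun x => ((σ : ℂ) * starRingEnd ℂ (Complex.exp ((W₁.phase s).φ * Complex.I))) ^ j • modeRepθ W₁ n 𝔹 G₀ F u (K0 + j • (fun i => (W₁.phase s).m i * (n : ℤ))) x) (p * W₁.period + W₁.start s) ((p * W₁.period + W₁.start s) + (W₁.phase s).τ) :=
    fun j => (absolutelyContinuousOnInterval_modeRepθ W₁ n hT.le h _ ht0I ht1I).const_smul _
  -- coercivity and upper norm bound of the twisted dampings, mode by mode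
  have hgj : ∀ (j : ℤ), ∀ t ∈ Icc (p * W₁.period + W₁.start s) ((p * W₁.period + W₁.start s) + (W₁.phase s).τ),
      (4 * Real.pi ^ 2 * lo * ∑ b, Torus.twistFreq G₀ (K0 + j • (fun i => (W₁.phase s).m i * (n : ℤ))) b ^ 2) * ‖((σ : ℂ) * starRingEnd ℂ (Complex.exp ((W₁.phase s).φ * Complex.I))) ^ j • modeRepθ W₁ n 𝔹 G₀ F u (K0 + j • (fun i => (W₁.phase s).m i * (n : ℤ))) t‖ ^ 2
        ≤ (⟪((4 * Real.pi ^ 2 : ℝ) : ℂ) • Torus.transversalProjR (Torus.twistFreq G₀ (K0 + j • (fun i => (W₁.phase s).m i * (n : ℤ))))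
            (Torus.symbT (Torus.majorTranspose (Torus.Visc4.conj G₀ 𝔹)) (K0 + j • (fun i => (W₁.phase s).m i * (n : ℤ))) (((σ : ℂ) * starRingEnd ℂ (Complex.exp ((W₁.phase s).φ * Complex.I))) ^ j • modeRepθ W₁ n 𝔹 G₀ F u (K0 + j • (fun i => (W₁.phase s).m i * (n : ℤ))) t)),
            ((σ : ℂ) * starRingEnd ℂ (Complex.exp ((W₁.phase s).φ * Complex.I))) ^ j • modeRepθ W₁ n 𝔹 G₀ F u (K0 + j • (fun i => (W₁.phase s).m i * (n : ℤ))) t⟫_ℂ).re := by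
    intro j t htI
    have h1 := coercivity_twistGen h𝔹T G₀ (K0 + j • (fun i => (W₁.phase s).m i * (n : ℤ))) _ (hTj j t htI)
    rw [hconjT] at h1
    exact h1
  have hYj : ∀ (j : ℤ), ∀ t ∈ Icc (p * W₁.period + W₁.start s) ((p * W₁.period + W₁.start s) + (W₁.phase s).τ),
      ‖((4 * Real.pi ^ 2 : ℝ) : ℂ) • Torus.transversalProjR (Torus.twistFreq G₀ (K0 + j • (fun i => (W₁.phase s).m i * (n : ℤ))))
          (Torus.symbT (Torus.majorTranspose (Torus.Visc4.conj G₀ 𝔹)) (K0 + j • (fun i => (W₁.phase s).m i * (n : ℤ))) (((σ : ℂ) * starRingEnd ℂ (Complex.exp ((W₁.phase s).φ * Complex.I))) ^ j • modeRepθ W₁ n 𝔹 G₀ F u (K0 + j • (fun i => (W₁.phase s).m i * (n : ℤ))) t))‖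
        ≤ 4 * Real.pi ^ 2 * (hi + β / 2) * (∑ b, Torus.twistFreq G₀ (K0 + j • (fun i => (W₁.phase s).m i * (n : ℤ))) b ^ 2) * ‖((σ : ℂ) * starRingEnd ℂ (Complex.exp ((W₁.phase s).φ * Complex.I))) ^ j • modeRepθ W₁ n 𝔹 G₀ F u (K0 + j • (fun i => (W₁.phase s).m i * (n : ℤ))) t‖ := by
    intro j t htI
    have h1 := norm_twistGen_le h𝔹T hlo.le hhi hoddT hβ G₀ (K0 + j • (fun i => (W₁.phase s).m i * (n : ℤ))) _ (hTj j t htI)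
    rw [hconjT] at h1
    exact h1
  have hg0 : ∀ t ∈ Icc (p * W₁.period + W₁.start s) ((p * W₁.period + W₁.start s) + (W₁.phase s).τ), d0 * ‖(((σ : ℂ) * starRingEnd ℂ (Complex.exp ((W₁.phase s).φ * Complex.I))) ^ (0:ℤ) • modeRepθ W₁ n 𝔹 G₀ F u (K0 + (0:ℤ) • (fun i => (W₁.phase s).m i * (n : ℤ))) t)‖ ^ 2 ≤ (⟪(((4 * Real.pi ^ 2 : ℝ) : ℂ) • Torus.transversalProjR (Torus.twistFreq G₀ (K0 + (0:ℤ) • (fun i => (W₁.phase s).m i * (n : ℤ)))) (Torus.symbT (Torus.majorTranspose (Torus.Visc4.conj G₀ 𝔹)) (K0 + (0:ℤ) • (fun i => (W₁.phase s).m i * (n : ℤ))) (((σ : ℂ) * starRingEnd ℂ (Complex.exp ((W₁.phase s).φ * Complex.I))) ^ (0:ℤ) • modeRepθ W₁ n 𝔹 G₀ F u (K0 + (0:ℤ) • (fun i => (W₁.phase s).m i * (n : ℤ))) t))), (((σ : ℂ) * starRingEnd ℂ (Complex.exp ((W₁.phase s).φ * Complex.I))) ^ (0:ℤ) • modeRepθ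 W₁ n 𝔹 G₀ F u (K0 + (0:ℤ) • (fun i => (W₁.phase s).m i * (n : ℤ))) t)⟫_ℂ).re :=
    fun t htI => (mul_le_mul_of_nonneg_right hd0le (sq_nonneg _)).trans (hgj 0 t htI)
  have hgp : ∀ t ∈ Icc (p * W₁.period + W₁.start s) ((p * W₁.period + W₁.start s) + (W₁.phase s).τ), dmin * ‖(((σ : ℂ) * starRingEnd ℂ (Complex.exp ((W₁.phase s).φ * Complex.I))) ^ (1:ℤ) • modeRepθ W₁ n 𝔹 G₀ F u (K0 + (1:ℤ) • (fun i => (W₁.phase s).m i * (n : ℤ))) t)‖ ^ 2 ≤ (⟪(((4 * Real.pi ^ 2 : ℝ) : ℂ) • Torus.transversalProjR (Torus.twistFreq G₀ (K0 + (1:ℤ) • (fun i => (W₁.phase s).m i * (n : ℤ)))) (Torus.symbT (Torus.majorTranspose (Torus.Visc4.conj G₀ 𝔹)) (K0 + (1:ℤ) • (fun i => (W₁.phase s).m i * (n : ℤ))) (((σ : ℂ) * starRingEnd ℂ (Complex.exp ((W₁.phase s).φ * Complex.I))) ^ (1:ℤ) • modeRepθ W₁ n 𝔹 G₀ F u (K0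 + (1:ℤ) • (fun i => (W₁.phase s).m i * (n : ℤ))) t))), (((σ : ℂ) * starRingEnd ℂ (Complex.exp ((W₁.phase s).φ * Complex.I))) ^ (1:ℤ) • modeRepθ W₁ n 𝔹 G₀ F u (K0 + (1:ℤ) • (fun i => (W₁.phase s).m i * (n : ℤ))) t)⟫_ℂ).re :=
    fun t htI => (mul_le_mul_of_nonneg_right hdp (sq_nonneg _)).trans (hgj 1 t htI)
  have hgm : ∀ t ∈ Icc (p * W₁.period + W₁.start s) ((p * W₁.period + W₁.start s) + (W₁.phase s).τ), dmin * ‖(((σ : ℂ) * starRingEnd ℂ (Complex.exp ((W₁.phase s).φ * Complex.I))) ^ (-1:ℤ) • modeRepθ W₁ n 𝔹 G₀ F u (K0 + (-1:ℤ) • (fun i => (W₁.phase s).m i * (n : ℤ))) t)‖ ^ 2 ≤ (⟪(((4 * Real.pi ^ 2 : ℝ) : ℂ) • Torus.transversalProjR (Torus.twistFreq G₀ (K0 + (-1:ℤ) • (fun i => (W₁.phase s).m i * (n : ℤ)))) (Torus.symbT (Torus.majorTranspose (Torus.Visc4.conj G₀ 𝔹)) (K0 + (-1:ℤ) • (fun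 i => (W₁.phase s).m i * (n : ℤ))) (((σ : ℂ) * starRingEnd ℂ (Complex.exp ((W₁.phase s).φ * Complex.I))) ^ (-1:ℤ) • modeRepθ W₁ n 𝔹 G₀ F u (K0 + (-1:ℤ) • (fun i => (W₁.phase s).m i * (n : ℤ))) t))), (((σ : ℂ) * starRingEnd ℂ (Complex.exp ((W₁.phase s).φ * Complex.I))) ^ (-1:ℤ) • modeRepθ W₁ n 𝔹 G₀ F u (K0 + (-1:ℤ) • (fun i => (W₁.phase s).m i * (n : ℤ))) t)⟫_ℂ).re :=
    fun t htI => (mul_le_mul_of_nonneg_right hdm (sq_nonneg _)).trans (hgj (-1) t htI)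
  have hgpp : ∀ t ∈ Icc (p * W₁.period + W₁.start s) ((p * W₁.period + W₁.start s) + (W₁.phase s).τ), dtwo * ‖(((σ : ℂ) * starRingEnd ℂ (Complex.exp ((W₁.phase s).φ * Complex.I))) ^ (2:ℤ) • modeRepθ W₁ n 𝔹 G₀ F u (K0 + (2:ℤ) • (fun i => (W₁.phase s).m i * (n : ℤ))) t)‖ ^ 2 ≤ (⟪(((4 * Real.pi ^ 2 : ℝ) : ℂ) • Torus.transversalProjR (Torus.twistFreq G₀ (K0 + (2:ℤ) • (fun i => (W₁.phase s).m i * (n : ℤ)))) (Torus.symbT (Torus.majorTranspose (Torus.Visc4.conj G₀ 𝔹)) (K0 + (2:ℤ) • (fun i => (W₁.phase s).m i * (n : ℤ))) (((σ : ℂ) * starRingEnd ℂ (Complex.exp ((W₁.phase s).φ * Complex.I))) ^ (2:ℤ) • modeRepθ W₁ n 𝔹 G₀ F u (K0 + (2:ℤ) • (fun i => (W₁.phase s).m i * (n : ℤ))) t))), (((σ : ℂ) * starRingEnd ℂ (Complex.exp ((W₁.phase s).φ * Complex.I))) ^ (2:ℤ) • modeRepθ W₁ n 𝔹 G₀ F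 u (K0 + (2:ℤ) • (fun i => (W₁.phase s).m i * (n : ℤ))) t)⟫_ℂ).re :=
    fun t htI => (mul_le_mul_of_nonneg_right hdpp (sq_nonneg _)).trans (hgj 2 t htI)
  have hgmm : ∀ t ∈ Icc (p * W₁.period + W₁.start s) ((p * W₁.period + W₁.start s) + (W₁.phase s).τ), dtwo * ‖(((σ : ℂ) * starRingEnd ℂ (Complex.exp ((W₁.phase s).φ * Complex.I))) ^ (-2:ℤ) • modeRepθ W₁ n 𝔹 G₀ F u (K0 + (-2:ℤ) • (fun i => (W₁.phase s).m i * (n : ℤ))) t)‖ ^ 2 ≤ (⟪(((4 * Real.pi ^ 2 : ℝ) : ℂ) • Torus.transversalProjR (Torus.twistFreq G₀ (K0 + (-2:ℤ) • (fun i => (W₁.phase s).m i * (n : ℤ)))) (Torus.symbT (Torus.majorTranspose (Torus.Visc4.conj G₀ 𝔹)) (K0 + (-2:ℤ) • (fun i => (W₁.phase s).m i * (n : ℤ))) (((σ : ℂ) * starRingEnd ℂ (Complex.exp ((W₁.phase s).φ * Complex.I))) ^ (-2:ℤ) • modeRepθ W₁ n 𝔹 G₀ F u (K0 + (-2:ℤ)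 • (fun i => (W₁.phase s).m i * (n : ℤ))) t))), (((σ : ℂ) * starRingEnd ℂ (Complex.exp ((W₁.phase s).φ * Complex.I))) ^ (-2:ℤ) • modeRepθ W₁ n 𝔹 G₀ F u (K0 + (-2:ℤ) • (fun i => (W₁.phase s).m i * (n : ℤ))) t)⟫_ℂ).re :=
    fun t htI => (mul_le_mul_of_nonneg_right hdmm (sq_nonneg _)).trans (hgj (-2) t htI)
  have hYp : ∀ t ∈ Icc (p * W₁.period + W₁.start s) ((p * W₁.period + W₁.start s) + (W₁.phase s).τ), ‖(((4 * Real.pi ^ 2 : ℝ) : ℂ) • Torus.transversalProjR (Torus.twistFreq G₀ (K0 + (1:ℤ) • (fun i => (W₁.phase s).m i * (n : ℤ)))) (Torus.symbT (Torus.majorTranspose (Torus.Visc4.conj G₀ 𝔹)) (K0 + (1:ℤ) • (fun i => (W₁.phase s).m i * (n : ℤ))) (((σ : ℂ) * starRingEnd ℂ (Complex.exp ((W₁.phase s).φ * Complex.I))) ^ (1:ℤ) • modeRepθ W₁ n 𝔹 G₀ F u (K0 + (1:ℤ) • (fun i => (W₁.phase s).m i * (n : ℤ))) t)))‖ ≤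 Dmax * ‖(((σ : ℂ) * starRingEnd ℂ (Complex.exp ((W₁.phase s).φ * Complex.I))) ^ (1:ℤ) • modeRepθ W₁ n 𝔹 G₀ F u (K0 + (1:ℤ) • (fun i => (W₁.phase s).m i * (n : ℤ))) t)‖ :=
    fun t htI => (hYj 1 t htI).trans (mul_le_mul_of_nonneg_right hDp (norm_nonneg _))
  have hYm : ∀ t ∈ Icc (p * W₁.period + W₁.start s) ((p * W₁.period + W₁.start s) + (W₁.phase s).τ), ‖(((4 * Real.pi ^ 2 : ℝ) : ℂ) • Torus.transversalProjR (Torus.twistFreq G₀ (K0 + (-1:ℤ) • (fun i => (W₁.phase s).m i * (n : ℤ)))) (Torus.symbT (Torus.majorTranspose (Torus.Visc4.conj G₀ 𝔹)) (K0 + (-1:ℤ) • (fun i => (W₁.phase s).m i * (n : ℤ))) (((σ : ℂ) * starRingEnd ℂ (Complex.exp ((W₁.phase s).φ * Complex.I))) ^ (-1:ℤ) • modeRepθ W₁ n 𝔹 G₀ F u (K0 + (-1:ℤ) • (fun i => (W₁.phase s).m i * (n : ℤ))) t)))‖ ≤ Dmax * ‖(((σ : ℂ) * starRingEnd ℂ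 (Complex.exp ((W₁.phase s).φ * Complex.I))) ^ (-1:ℤ) • modeRepθ W₁ n 𝔹 G₀ F u (K0 + (-1:ℤ) • (fun i => (W₁.phase s).m i * (n : ℤ))) t)‖ :=
    fun t htI => (hYj (-1) t htI).trans (mul_le_mul_of_nonneg_right hDm (norm_nonneg _))
  have hY0 : ∀ t ∈ Icc (p * W₁.period + W₁.start s) ((p * W₁.period + W₁.start s) + (W₁.phase s).τ), ‖(((4 * Real.pi ^ 2 : ℝ) : ℂ) • Torus.transversalProjR (Torus.twistFreq G₀ (K0 + (0:ℤ) • (fun i => (W₁.phase s).m i * (n : ℤ)))) (Torus.symbT (Torus.majorTranspose (Torus.Visc4.conj G₀ 𝔹)) (K0 + (0:ℤ) • (fun i => (W₁.phase s).m i * (n : ℤ))) (((σ : ℂ) * starRingEnd ℂ (Complex.exp ((W₁.phase s).φ * Complex.I))) ^ (0:ℤ) • modeRepθ W₁ n 𝔹 G₀ F u (K0 + (0:ℤ) • (fun i => (W₁.phase s).m i * (n : ℤ))) t)))‖ ≤ D0 * ‖(((σ : ℂ) * starRingEnd ℂ (Complex.exp ((W₁.phase s).φ * Complex.I))) ^ (0:ℤ)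 • modeRepθ W₁ n 𝔹 G₀ F u (K0 + (0:ℤ) • (fun i => (W₁.phase s).m i * (n : ℤ))) t)‖ :=
    fun t htI => (hYj 0 t htI).trans (mul_le_mul_of_nonneg_right hD0ge (norm_nonneg _))
  have hqw' : ∀ t ∈ Icc (p * W₁.period + W₁.start s) ((p * W₁.period + W₁.start s) + (W₁.phase s).τ), q * ‖(((σ : ℂ) * starRingEnd ℂ (Complex.exp ((W₁.phase s).φ * Complex.I))) ^ (0:ℤ) • modeRepθ W₁ n 𝔹 G₀ F u (K0 + (0:ℤ) • (fun i => (W₁.phase s).m i * (n : ℤ))) t)‖ ^ 2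
      ≤ ‖Torus.transversalProjR (Torus.twistFreq G₀ (K0 + (1:ℤ) • (fun i => (W₁.phase s).m i * (n : ℤ)))) (((σ : ℂ) * starRingEnd ℂ (Complex.exp ((W₁.phase s).φ * Complex.I))) ^ (0:ℤ) • modeRepθ W₁ n 𝔹 G₀ F u (K0 + (0:ℤ) • (fun i => (W₁.phase s).m i * (n : ℤ))) t)‖ ^ 2 + ‖Torus.transversalProjR (Torus.twistFreq G₀ (K0 + (-1:ℤ) • (fun i => (W₁.phase s).m i * (n : ℤ)))) (((σ : ℂ) * starRingEnd ℂ (Complex.exp ((W₁.phase s).φ * Complex.I))) ^ (0:ℤ) • modeRepθ W₁ n 𝔹 G₀ F u (K0 + (0:ℤ) • (fun i => (W₁.phase s).m i * (n : ℤ))) t)‖ ^ 2 :=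
    fun t htI => hqw _ (hTj 0 t htI)
  -- the energy: absolute continuity on the slot, a.e. derivative, the chain's share, the dissipation split
  have hEac' : AbsolutelyContinuousOnInterval E (p * W₁.period + W₁.start s) ((p * W₁.period + W₁.start s) + (W₁.phase s).τ) := hEac _ ht0I _ ht1I
  have hEd' : ∀ᵐ t, t ∈ uIcc (p * W₁.period + W₁.start s) ((p * W₁.period + W₁.start s) + (W₁.phase s).τ) → HasDerivAt E (-2 * Q t) t := ae_uIcc_hasDerivAt_energy ht₀ hlt.le ht₁ hEd
  have hE5 : ∀ t ∈ Icc (p * W₁.period + W₁.start s) ((p * W₁.period + W₁.start s) + (W₁.phase s).τ), 2 * (‖(((σ : ℂ) * starRingEnd ℂ (Complex.exp ((W₁.phase s).φ * Complex.I))) ^ (0:ℤ) • modeRepθ W₁ n 𝔹 G₀ F u (K0 + (0:ℤ) • (fun i => (W₁.phase s).m i * (n : ℤ))) t)‖ ^ 2 + ‖(((σ : ℂ) * starRingEnd ℂ (Complex.exp ((W₁.phase s).φ * Complex.I))) ^ (1:ℤ) • modeRepθ W₁ n 𝔹 G₀ F u (K0 + (1:ℤ) • (fun i => (W₁.phase s).m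 i * (n : ℤ))) t)‖ ^ 2 + ‖(((σ : ℂ) * starRingEnd ℂ (Complex.exp ((W₁.phase s).φ * Complex.I))) ^ (-1:ℤ) • modeRepθ W₁ n 𝔹 G₀ F u (K0 + (-1:ℤ) • (fun i => (W₁.phase s).m i * (n : ℤ))) t)‖ ^ 2 + ‖(((σ : ℂ) * starRingEnd ℂ (Complex.exp ((W₁.phase s).φ * Complex.I))) ^ (2:ℤ) • modeRepθ W₁ n 𝔹 G₀ F u (K0 + (2:ℤ) • (fun i => (W₁.phase s).m i * (n : ℤ))) t)‖ ^ 2 + ‖(((σ : ℂ) * starRingEnd ℂ (Complex.exp ((W₁.phase s).φ * Complex.I))) ^ (-2:ℤ) • modeRepθ W₁ n 𝔹 G₀ F u (K0 + (-2:ℤ) • (fun i => (W₁.phase s).m i * (n : ℤ))) t)‖ ^ 2) ≤ E t := by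
    intro t htI
    exact five_norm_sq_le_energy_frame W₁ n hT h hF s K0 hσ hKs hdisj hEcont hEae t (hsubI htI)
  have hQ' : ∀ᵐ t, t ∈ uIcc (p * W₁.period + W₁.start s) ((p * W₁.period + W₁.start s) + (W₁.phase s).τ) →
      2 * ((⟪(((4 * Real.pi ^ 2 : ℝ) : ℂ) • Torus.transversalProjR (Torus.twistFreq G₀ (K0 + (0:ℤ) • (fun i => (W₁.phase s).m i * (n : ℤ)))) (Torus.symbT (Torus.majorTranspose (Torus.Visc4.conj G₀ 𝔹)) (K0 + (0:ℤ) • (fun i => (W₁.phase s).m i * (n : ℤ))) (((σ : ℂ) * starRingEnd ℂ (Complex.exp ((W₁.phase s).φ * Complex.I))) ^ (0:ℤ) • modeRepθ W₁ n 𝔹 G₀ F u (K0 + (0:ℤ) • (fun i => (W₁.phase s).m i * (n : ℤ))) t))), (((σ : ℂ) * starRingEnd ℂ (Complex.exp ((W₁.phase s).φ * Complex.I))) ^ (0:ℤ) • modeRepθ W₁ n 𝔹 G₀ F u (K0 + (0:ℤ) • (fun i => (W₁.phase s).m i * (n : ℤ))) t)⟫_ℂ).re + (⟪(((4 * Real.pi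 ^ 2 : ℝ) : ℂ) • Torus.transversalProjR (Torus.twistFreq G₀ (K0 + (1:ℤ) • (fun i => (W₁.phase s).m i * (n : ℤ)))) (Torus.symbT (Torus.majorTranspose (Torus.Visc4.conj G₀ 𝔹)) (K0 + (1:ℤ) • (fun i => (W₁.phase s).m i * (n : ℤ))) (((σ : ℂ) * starRingEnd ℂ (Complex.exp ((W₁.phase s).φ * Complex.I))) ^ (1:ℤ) • modeRepθ W₁ n 𝔹 G₀ F u (K0 + (1:ℤ) • (fun i => (W₁.phase s).m i * (n : ℤ))) t))), (((σ : ℂ) * starRingEnd ℂ (Complex.exp ((W₁.phase s).φ * Complex.I))) ^ (1:ℤ) • modeRepθ W₁ n 𝔹 G₀ F u (K0 + (1:ℤ) • (fun i => (W₁.phase s).m i * (n : ℤ))) t)⟫_ℂ).re + (⟪(((4 * Real.pi ^ 2 : ℝ) : ℂ) • Torus.transversalProjR (Torus.twistFreq G₀ (K0 + (-1:ℤ) • (fun i => (W₁.phase s).m i * (n : ℤ)))) (Torus.symbT (Torus.majorTranspose (Torus.Visc4.conj G₀ 𝔹)) (K0 + (-1:ℤ) • (fun i => (W₁.phase s).m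 i * (n : ℤ))) (((σ : ℂ) * starRingEnd ℂ (Complex.exp ((W₁.phase s).φ * Complex.I))) ^ (-1:ℤ) • modeRepθ W₁ n 𝔹 G₀ F u (K0 + (-1:ℤ) • (fun i => (W₁.phase s).m i * (n : ℤ))) t))), (((σ : ℂ) * starRingEnd ℂ (Complex.exp ((W₁.phase s).φ * Complex.I))) ^ (-1:ℤ) • modeRepθ W₁ n 𝔹 G₀ F u (K0 + (-1:ℤ) • (fun i => (W₁.phase s).m i * (n : ℤ))) t)⟫_ℂ).re + (⟪(((4 * Real.pi ^ 2 : ℝ) : ℂ) • Torus.transversalProjR (Torus.twistFreq G₀ (K0 + (2:ℤ) • (fun i => (W₁.phase s).m i * (n : ℤ)))) (Torus.symbT (Torus.majorTranspose (Torus.Visc4.conj G₀ 𝔹)) (K0 + (2:ℤ) • (fun i => (W₁.phase s).m i * (n : ℤ))) (((σ : ℂ) * starRingEnd ℂ (Complex.exp ((W₁.phase s).φ * Complex.I))) ^ (2:ℤ) • modeRepθ W₁ n 𝔹 G₀ F u (K0 + (2:ℤ) • (fun i => (W₁.phase s).m i * (n : ℤ))) t))), (((σ : ℂ) * starRingEnd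 ℂ (Complex.exp ((W₁.phase s).φ * Complex.I))) ^ (2:ℤ) • modeRepθ W₁ n 𝔹 G₀ F u (K0 + (2:ℤ) • (fun i => (W₁.phase s).m i * (n : ℤ))) t)⟫_ℂ).re + (⟪(((4 * Real.pi ^ 2 : ℝ) : ℂ) • Torus.transversalProjR (Torus.twistFreq G₀ (K0 + (-2:ℤ) • (fun i => (W₁.phase s).m i * (n : ℤ)))) (Torus.symbT (Torus.majorTranspose (Torus.Visc4.conj G₀ 𝔹)) (K0 + (-2:ℤ) • (fun i => (W₁.phase s).m i * (n : ℤ))) (((σ : ℂ) * starRingEnd ℂ (Complex.exp ((W₁.phase s).φ * Complex.I))) ^ (-2:ℤ) • modeRepθ W₁ n 𝔹 G₀ F u (K0 + (-2:ℤ) • (fun i => (W₁.phase s).m i * (n : ℤ))) t))), (((σ : ℂ) * starRingEnd ℂ (Complex.exp ((W₁.phase s).φ * Complex.I))) ^ (-2:ℤ) • modeRepθ W₁ n 𝔹 G₀ F u (K0 + (-2:ℤ) • (fun i => (W₁.phase s).m i * (n : ℤ))) t)⟫_ℂ).re) + (dmin / 2) * (E t - 2 * (‖(((σ : ℂ) *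 starRingEnd ℂ (Complex.exp ((W₁.phase s).φ * Complex.I))) ^ (0:ℤ) • modeRepθ W₁ n 𝔹 G₀ F u (K0 + (0:ℤ) • (fun i => (W₁.phase s).m i * (n : ℤ))) t)‖ ^ 2 + ‖(((σ : ℂ) * starRingEnd ℂ (Complex.exp ((W₁.phase s).φ * Complex.I))) ^ (1:ℤ) • modeRepθ W₁ n 𝔹 G₀ F u (K0 + (1:ℤ) • (fun i => (W₁.phase s).m i * (n : ℤ))) t)‖ ^ 2 + ‖(((σ : ℂ) * starRingEnd ℂ (Complex.exp ((W₁.phase s).φ * Complex.I))) ^ (-1:ℤ) • modeRepθ W₁ n 𝔹 G₀ F u (K0 + (-1:ℤ) • (fun i => (W₁.phase s).m i * (n : ℤ))) t)‖ ^ 2 + ‖(((σ : ℂ) * starRingEnd ℂ (Complex.exp ((W₁.phase s).φ * Complex.I))) ^ (2:ℤ) • modeRepθ W₁ n 𝔹 G₀ F u (K0 + (2:ℤ) • (fun i => (W₁.phase s).m i * (n : ℤ))) t)‖ ^ 2 + ‖(((σ : ℂ) * starRingEnd ℂ (Complex.exp ((W₁.phase s).φ * Complex.I))) ^ (-2:ℤ)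 • modeRepθ W₁ n 𝔹 G₀ F u (K0 + (-2:ℤ) • (fun i => (W₁.phase s).m i * (n : ℤ))) t)‖ ^ 2)) ≤ Q t :=
    ae_uIcc_pair_split_frame W₁ n hT.le h hF s K0 hσ hKs hdisj hEae hQS hcoer hdmin.le hgap ht₀ hlt.le ht₁
  -- THE ABSTRACT SLOT STEP (generic dampings, real wave vectors)
  have hstep := slot_stepR hlt (μ := 2) (by norm_num) hc0 hε hd0 hdmin hdtwo hD0 hdD c1 c2 c3 c4
    (continuous_trapezoid _ _ _) hA01 (trapezoid_left hτ hρ _) (trapezoid_right hτ hρ _) (absolutelyContinuousOnInterval_trapezoid _ hτ hρ _ _) hAd1 hAd2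
    (hTj 0) (hTY 1) (hTY (-1)) hg0 hgp hgm hgpp hgmm hYp hYm hY0 hqw' (hacj 0) (hacj 1) (hacj (-1)) hd0' hdp' hdm' hEac' hEd' hE5 hQ'
  rw [hτeq] at hstep
  have hI := slot_rate_floor (t₀ := (p * W₁.period + W₁.start s)) hε hq0 hq2 hdmin hτ hramp c1 c3 c5
  have hE0 : 0 ≤ E (p * W₁.period + W₁.start s) := by
    have h5 := hE5 (p * W₁.period + W₁.start s) ⟨le_rfl, hlt.le⟩
    have : 0 ≤ ‖(((σ : ℂ) * starRingEnd ℂ (Complex.exp ((W₁.phase s).φ * Complex.I))) ^ (0:ℤ) • modeRepθ W₁ n 𝔹 G₀ F u (K0 + (0:ℤ) • (fun i => (W₁.phase s).m i * (n : ℤ))) (p * W₁.period + W₁.start s))‖ ^ 2 + ‖(((σ : ℂ) * starRingEnd ℂ (Complex.exp ((W₁.phase s).φ * Complex.I))) ^ (1:ℤ) • modeRepθ W₁ n 𝔹 G₀ F u (K0 + (1:ℤ) • (fun i => (W₁.phase s).m i * (n : ℤ))) (p * W₁.period + W₁.start s))‖ ^ 2 + ‖(((σ : ℂ) * starRingEnd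 ℂ (Complex.exp ((W₁.phase s).φ * Complex.I))) ^ (-1:ℤ) • modeRepθ W₁ n 𝔹 G₀ F u (K0 + (-1:ℤ) • (fun i => (W₁.phase s).m i * (n : ℤ))) (p * W₁.period + W₁.start s))‖ ^ 2 + ‖(((σ : ℂ) * starRingEnd ℂ (Complex.exp ((W₁.phase s).φ * Complex.I))) ^ (2:ℤ) • modeRepθ W₁ n 𝔹 G₀ F u (K0 + (2:ℤ) • (fun i => (W₁.phase s).m i * (n : ℤ))) (p * W₁.period + W₁.start s))‖ ^ 2 + ‖(((σ : ℂ) * starRingEnd ℂ (Complex.exp ((W₁.phase s).φ * Complex.I))) ^ (-2:ℤ) • modeRepθ W₁ n 𝔹 G₀ F u (K0 + (-2:ℤ) • (fun i => (W₁.phase s).m i * (n : ℤ))) (p * W₁.period + W₁.start s))‖ ^ 2 := by positivity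
    linarith
  calc E ((p * W₁.period + W₁.start s) + (W₁.phase s).τ) ≤ _ := hstep
    _ ≤ Real.exp (-(ε * c ^ 2 * q * (W₁.phase s).τ / 27)) * E (p * W₁.period + W₁.start s) :=
        mul_le_mul_of_nonneg_right (Real.exp_le_exp.2 (by linarith)) hE0

end Summit.AnomalousDissipation.AnomalousDissipation.Theorems.SolenoidalFractalHomogenisation.LagrangianStep.W7Cell

end
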